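import Summits.ResolutionOfSingularities.ResolutionOfSingularities.Theorems.EquisingularLiftEquisingularLiftNatResidueHypDefs10
import HarnessLib

/-!
# [OURS · L1 W4.5(b) · EL♮ / EL♮(3)] RESIDUE HYPOTHESIS DEFS 11 — WIDTH TABLE W₂ «Σ-SECTION ROUND» on the ISO residue: `PrefixReachKeyLetterParam9` (= …Defs10's
# `PrefixReachKeyLetterParam8` VERBATIM + TWO PREFIX CLAUSES (HR-SEC) and (P-ram)), `PrefixReachKeyLetterP9`, the blob `IsoHypReachNDLeavesP9`, pure inclusions

Typed by res-type-027 g23 on the desk's RULING R73 (2026-08-29T07:29:53Z; W₂ DEALT on the certified customer Q47₂ — lead-1 g19 memo v3.7 aa5bc6b8c8a1f393, crit-3 g10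
W₂ WALK l.86245) as AMENDED by ★★ R73a (07:33:53Z: PLACEMENT = TWO PREFIX CLAUSES, NOT a tail rule — on the ISO prefix the host E_Z of the section Γ′ is a LISTED letter,
never a tail host; letters of record = idea-2 g30 ⚠ BY TYPE l.86296; my first (tail-rule) signature 3898ea9454156287 is WITHDRAWN).  WHAT.
(1) `PrefixReachKeyLetterParam9 k n H ι Reach ReachL LS Open F' ρ' T'` = `PrefixReachKeyLetterParam8` (…Defs10 :45–:195) VERBATIM — (0) START, (D) DROP, (Pc), (PL), (i), (O),
(ii), (HR-KEEP-N) — with TWO clauses APPENDED before END: **(HR-SEC)** := the (HR-KEEP-N) clause (:167–:191) with (N2) «`Ẽ₁` regular along `Z̃`» REPLACED by (L2)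
`∀ z ∈ Z, IsClosed {z} → ∃ f : 𝒪_{F₁,z}, stalkIdeal 𝓘⟨Z⟩ z = stalkIdeal 𝓘⟨closure E₁⟩ z ⊔ span {f} ∧ f ∉ stalkIdeal 𝓘⟨closure E₁⟩ z ⊔ 𝔪_z²` («`Z̃` is cut on `Ẽ₁` at every
closed point by ONE element that is a PARAMETER of `Ẽ₁`») and (N4) (the ψ block :175–:183) DELETED, everything else (E₁ ∈ Ls, Z ⊆ closure E₁, Z ⊆ T₁, ¬ T₁ ⊆ Z, (N1),
(N3) `DirStepUnobs`, curve clause, MEMBERS block, `IsBlowup`, OUTPUT `Q F₃ (υ' ≫ ρ) (St T₁) (Ls.map St ++ [υ'⁻¹Z]) none`) byte-identical; **(P-ram)** := the tail rule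
`TowerPtRamB₄`'s letters (…NatTowerRoundBTriplePrimeDefs :69–:76) re-registered at PREFIX level, hostless, letters and tag DROPPED: at a closed non-regular point `y` of `T̃`
where the AMBIENT is NOT regular, blow up a prescribed ideal `J` supported at the point and generated in the stalk by three elements of `𝔪` independent in `𝔪/𝔪²`;
output `Q F₂ (υ₂ ≫ ρ) (closure (υ₂⁻¹(T₁ ∖ {pt}))) [] none`.  (2) `PrefixReachKeyLetterP9` := Param9 at the four slots of record (`ReachTowerBTriplePrime`,
`ReachTowerBQuintPrime ℙ`, `HyperplaneLetters`, `OpeningCertKeyLetter`) — tails UNCHANGED; `IsoHypReachNDLeavesP9 := ∃ F ρ T m, PrefixReachKeyLetterP9 … ∧ ND.NDInvCLNP n k m F ρ T`.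
(3) PURE LOGIC: `prefixReachKeyLetterParam9_of_param8` (two ADDED closure hypotheses on `Q` — a motive asked to be closed under more moves), `prefixReachKeyLetterP9_of_P8`,
★ `isoHypReachNDLeavesP9_of_P8` (+ `_of_P7` / `_of_P6` / `_of_P5` / `_of_P`) and the 48th's REPLACE lemma `not_isoHypReachNDLeavesP8_of_not_P9`: the cut
`¬ IsoHypReachNDLeavesP8 ↦ ¬ IsoHypReachNDLeavesP9` loses nothing.  Customer sentence (Q47₂, crit-3 l.86245 / idea-2 l.86296): (HR-KEEP-N) at Γ_b → (HR-SEC) at Γ′ with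
E₁ = E_Z ∈ Ls → 18 × (P-ram) at the deep A₁'s Q″± → END m = 0.  ENGINE (NOT in this file; R73a (ii)): (HR-SEC) bullet = ✓ p704265 `embeddedLiftFact_holds` + (u2) (nose-w1);
(P-ram) bullet = the nose engine's B₄ bullet ported to the ISO prefix engine (stub-4 / the ISO-engine seat).  HONEST: two clauses in the text, two engine bullets owed; nothing
of EL♮(3) is proved by a wider door.
House style R21″ (C): definitions + pure-logic lemmas; no `sorry`, no instance, no notation; standard axioms.  OURS; NAMED HYPOTHESES, not statements of
any manuscript; nothing of [Hironaka2017] is asserted; AI-written, weaker than expert review; EL♮(3) NOT proved; resolution in positive characteristic NOT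
proved (dim 3 = Cossart–Piltant 2008/2009).  `--kind definition --supports stmt-ResolutionOfSingularities-20148 --as helper`.
-/

set_option linter.dupNamespace false
noncomputable section
open CategoryTheory CategoryTheory.Limits AlgebraicGeometry TopologicalSpace Topology IsLocalRing
open Literature.AlgebraicGeometry.Resolution
open AlgebraicGeometry.Scheme.IdealSheafData
namespace Summit.ResolutionOfSingularities.ResolutionOfSingularities.Cruxes.EquisingularLiftNat.Sections

/-- **`PrefixReachKeyLetterParam9 k n H ι Reach ReachL LS Open F' ρ' T'`** — …Defs10's `PrefixReachKeyLetterParam8` VERBATIM with TWO clauses APPENDED (WIDTH TABLE W₂,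
desk R73/R73a; idea-2 g30 l.86296): (HR-SEC) the Σ-SECTION HOSTED ROUND (= (HR-KEEP-N) with (N2) ↦ (L2) «Cartier-by-parameter in the host», (N4) deleted) and (P-ram) the
RAMIFIED POINT STEP at a prefix point with a prescribed three-generator centre (= `TowerPtRamB₄`'s letters, hostless, letters and tag dropped).  Same parameters and slots.
[OURS · named predicate; the two new suppliers = engine bullets owed by the ISO-engine seat] -/
def PrefixReachKeyLetterParam9 (k : Type) [Field k] [IsAlgClosed k] (n : ℕ) (H : AlgebraicGeometry.Scheme.{0})
    (ι : H ⟶ (Literature.AlgebraicGeometry.Motives.projectiveSpace n k).left)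
    (Reach : ∀ (F₁ F₂ : AlgebraicGeometry.Scheme.{0}), (F₂ ⟶ F₁) → F₁ → Set F₂ → ∀ (F₉ : AlgebraicGeometry.Scheme.{0}), (F₉ ⟶ F₂) → Set F₉ → Prop)
    (ReachL : ∀ (F₂ : AlgebraicGeometry.Scheme.{0}), (F₂ ⟶ (Literature.AlgebraicGeometry.Motives.projectiveSpace n k).left) →
      (Literature.AlgebraicGeometry.Motives.projectiveSpace n k).left → Set F₂ → List (Set F₂) → ∀ (F₉ : AlgebraicGeometry.Scheme.{0}), (F₉ ⟶ F₂) → Set F₉ → Prop)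
    (LS : ∀ (F₂ : AlgebraicGeometry.Scheme.{0}), (F₂ ⟶ (Literature.AlgebraicGeometry.Motives.projectiveSpace n k).left) →
      (Literature.AlgebraicGeometry.Motives.projectiveSpace n k).left → List (Set F₂) → Prop)
    (Open : ∀ (F₃ : AlgebraicGeometry.Scheme.{0}), (F₃ ⟶ (Literature.AlgebraicGeometry.Motives.projectiveSpace n k).left) → Set F₃ → List (Set F₃) →
      Option (Set F₃ × Set F₃ × Set F₃) → Prop)
    (F' : AlgebraicGeometry.Scheme.{0}) (ρ' : F' ⟶ (Literature.AlgebraicGeometry.Motives.projectiveSpace n k).left) (T' : Set F') : Prop :=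
  ∀ Q : (∀ F₁ : AlgebraicGeometry.Scheme.{0}, (F₁ ⟶ (Literature.AlgebraicGeometry.Motives.projectiveSpace n k).left) → Set F₁ → List (Set F₁) →
      Option (Set F₁ × Set F₁ × Set F₁) → Prop),
    -- (0) START: no letters, no tag
    Q (Literature.AlgebraicGeometry.Motives.projectiveSpace n k).left (𝟙 (Literature.AlgebraicGeometry.Motives.projectiveSpace n k).left) (Set.range ι) [] none →
    -- (D) DROP: forget listed letters (any sublist, as a set of names) and/or the tag
    (∀ (F₁ : AlgebraicGeometry.Scheme.{0}) (ρ : F₁ ⟶ (Literature.AlgebraicGeometry.Motives.projectiveSpace n k).left) (T₁ : Set F₁) (Ls Ls' : List (Set F₁))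
        (Kp Kp' : Option (Set F₁ × Set F₁ × Set F₁)),
      Q F₁ ρ T₁ Ls Kp → (∀ L ∈ Ls', L ∈ Ls) → (Kp' = Kp ∨ Kp' = none) → Q F₁ ρ T₁ Ls' Kp') →
    -- (Pc) K5′'s POINT STEP + `Reach`-moves (PrefixReachBQuadPrime's first clause), from ANY slots, letters and tag DROPPED
    (∀ (F₁ F₂ : AlgebraicGeometry.Scheme.{0}) (ρ : F₁ ⟶ (Literature.AlgebraicGeometry.Motives.projectiveSpace n k).left) (T₁ : Set F₁) (Ls : List (Set F₁))
        (Kp : Option (Set F₁ × Set F₁ × Set F₁))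
        (x : ↥(AlgebraicGeometry.Scheme.IdealSheafData.vanishingIdeal (⟨closure T₁, isClosed_closure⟩ : TopologicalSpace.Closeds F₁)).subscheme) (υ : F₂ ⟶ F₁)
        (hx : IsClosed ({((AlgebraicGeometry.Scheme.IdealSheafData.vanishingIdeal
          (⟨closure T₁, isClosed_closure⟩ : TopologicalSpace.Closeds F₁)).subschemeι x : F₁)} : Set F₁)), Q F₁ ρ T₁ Ls Kp →
      ¬ IsRegularLocalRing ((AlgebraicGeometry.Scheme.IdealSheafData.vanishingIdeal
          (⟨closure T₁, isClosed_closure⟩ : TopologicalSpace.Closeds F₁)).subscheme.presheaf.stalk x) →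
      IsRegularLocalRing (F₁.presheaf.stalk ((AlgebraicGeometry.Scheme.IdealSheafData.vanishingIdeal
          (⟨closure T₁, isClosed_closure⟩ : TopologicalSpace.Closeds F₁)).subschemeι x)) → Literature.AlgebraicGeometry.Resolution.IsBlowup υ
        (AlgebraicGeometry.Scheme.IdealSheafData.vanishingIdeal (⟨{((AlgebraicGeometry.Scheme.IdealSheafData.vanishingIdeal
            (⟨closure T₁, isClosed_closure⟩ : TopologicalSpace.Closeds F₁)).subschemeι x : F₁)}, hx⟩ : TopologicalSpace.Closeds F₁)) →
      Q F₂ (υ ≫ ρ) (closure (υ ⁻¹' (T₁ \ {((AlgebraicGeometry.Scheme.IdealSheafData.vanishingIdeal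
          (⟨closure T₁, isClosed_closure⟩ : TopologicalSpace.Closeds F₁)).subschemeι x : F₁)}))) [] none ∧ (∀ (F₉ : AlgebraicGeometry.Scheme.{0}) (β : F₉ ⟶ F₂) (T₉ : Set F₉),
        Reach F₁ F₂ υ ((AlgebraicGeometry.Scheme.IdealSheafData.vanishingIdeal (⟨closure T₁, isClosed_closure⟩ : TopologicalSpace.Closeds F₁)).subschemeι x)
          (closure (υ ⁻¹' (T₁ \ {((AlgebraicGeometry.Scheme.IdealSheafData.vanishingIdeal
            (⟨closure T₁, isClosed_closure⟩ : TopologicalSpace.Closeds F₁)).subschemeι x : F₁)}))) F₉ β T₉ → Q F₉ ((β ≫ υ) ≫ ρ) T₉ [] none)) →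
    -- (PL) A⁗: at the INITIAL stage only, LETTERED `ReachL`-towers after a good point step (PrefixReachBQuadPrime's second clause), conclusion at `[] none`
    (∀ (F₂ : AlgebraicGeometry.Scheme.{0}) (x₀ : ↥(AlgebraicGeometry.Scheme.IdealSheafData.vanishingIdeal
          (⟨closure (Set.range ι), isClosed_closure⟩ : TopologicalSpace.Closeds (Literature.AlgebraicGeometry.Motives.projectiveSpace n k).left)).subscheme)
        (υ : F₂ ⟶ (Literature.AlgebraicGeometry.Motives.projectiveSpace n k).left) (hx₀ : IsClosed ({((AlgebraicGeometry.Scheme.IdealSheafData.vanishingIdeal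
          (⟨closure (Set.range ι), isClosed_closure⟩ : TopologicalSpace.Closeds (Literature.AlgebraicGeometry.Motives.projectiveSpace n k).left)).subschemeι x₀ : (Literature.AlgebraicGeometry.Motives.projectiveSpace n k).left)} : Set (Literature.AlgebraicGeometry.Motives.projectiveSpace n k).left))
        (Ls₂ : List (Set F₂)), ¬ IsRegularLocalRing ((AlgebraicGeometry.Scheme.IdealSheafData.vanishingIdeal
          (⟨closure (Set.range ι), isClosed_closure⟩ : TopologicalSpace.Closeds (Literature.AlgebraicGeometry.Motives.projectiveSpace n k).left)).subscheme.presheaf.stalk x₀) →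
      IsRegularLocalRing ((Literature.AlgebraicGeometry.Motives.projectiveSpace n k).left.presheaf.stalk ((AlgebraicGeometry.Scheme.IdealSheafData.vanishingIdeal
          (⟨closure (Set.range ι), isClosed_closure⟩ : TopologicalSpace.Closeds (Literature.AlgebraicGeometry.Motives.projectiveSpace n k).left)).subschemeι x₀ : (Literature.AlgebraicGeometry.Motives.projectiveSpace n k).left)) →
      Literature.AlgebraicGeometry.Resolution.IsBlowup υ (AlgebraicGeometry.Scheme.IdealSheafData.vanishingIdeal (⟨{((AlgebraicGeometry.Scheme.IdealSheafData.vanishingIdeal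
          (⟨closure (Set.range ι), isClosed_closure⟩ : TopologicalSpace.Closeds (Literature.AlgebraicGeometry.Motives.projectiveSpace n k).left)).subschemeι x₀ : (Literature.AlgebraicGeometry.Motives.projectiveSpace n k).left)}, hx₀⟩ : TopologicalSpace.Closeds (Literature.AlgebraicGeometry.Motives.projectiveSpace n k).left)) →
      LS F₂ υ ((AlgebraicGeometry.Scheme.IdealSheafData.vanishingIdeal
          (⟨closure (Set.range ι), isClosed_closure⟩ : TopologicalSpace.Closeds (Literature.AlgebraicGeometry.Motives.projectiveSpace n k).left)).subschemeι x₀ : (Literature.AlgebraicGeometry.Motives.projectiveSpace n k).left) Ls₂ →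
      ∀ (F₉ : AlgebraicGeometry.Scheme.{0}) (β : F₉ ⟶ F₂) (T₉ : Set F₉), ReachL F₂ υ ((AlgebraicGeometry.Scheme.IdealSheafData.vanishingIdeal
          (⟨closure (Set.range ι), isClosed_closure⟩ : TopologicalSpace.Closeds (Literature.AlgebraicGeometry.Motives.projectiveSpace n k).left)).subschemeι x₀ : (Literature.AlgebraicGeometry.Motives.projectiveSpace n k).left) (closure (υ ⁻¹' (Set.range ι \ {((AlgebraicGeometry.Scheme.IdealSheafData.vanishingIdeal
          (⟨closure (Set.range ι), isClosed_closure⟩ : TopologicalSpace.Closeds (Literature.AlgebraicGeometry.Motives.projectiveSpace n k).left)).subschemeι x₀ : (Literature.AlgebraicGeometry.Motives.projectiveSpace n k).left)}))) Ls₂ F₉ β T₉ →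
        Q F₉ (β ≫ υ) T₉ [] none) →
    -- (i) LETTERED POINT STEP at a closed non-regular point of `T̃`, regular on `F`: at most ONE listed letter THROUGH the point (`Lt = some L`: nested section,
    --     `L̃` regular at the point), every other listed letter AWAY, the tag's three letters AWAY; letters `↦ St`, tag `↦ St`, optional birth of `E_x = υ⁻¹{x}`
    (∀ (F₁ F₂ : AlgebraicGeometry.Scheme.{0}) (ρ : F₁ ⟶ (Literature.AlgebraicGeometry.Motives.projectiveSpace n k).left) (T₁ : Set F₁) (Ls : List (Set F₁))
        (Kp : Option (Set F₁ × Set F₁ × Set F₁)) (Lt : Option (Set F₁))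
        (x : ↥(AlgebraicGeometry.Scheme.IdealSheafData.vanishingIdeal (⟨closure T₁, isClosed_closure⟩ : TopologicalSpace.Closeds F₁)).subscheme) (υ : F₂ ⟶ F₁)
        (hx : IsClosed ({((AlgebraicGeometry.Scheme.IdealSheafData.vanishingIdeal
          (⟨closure T₁, isClosed_closure⟩ : TopologicalSpace.Closeds F₁)).subschemeι x : F₁)} : Set F₁)), Q F₁ ρ T₁ Ls Kp →
      ¬ IsRegularLocalRing ((AlgebraicGeometry.Scheme.IdealSheafData.vanishingIdeal
          (⟨closure T₁, isClosed_closure⟩ : TopologicalSpace.Closeds F₁)).subscheme.presheaf.stalk x) →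
      IsRegularLocalRing (F₁.presheaf.stalk ((AlgebraicGeometry.Scheme.IdealSheafData.vanishingIdeal
          (⟨closure T₁, isClosed_closure⟩ : TopologicalSpace.Closeds F₁)).subschemeι x)) →
      (∀ L ∈ Ls, ((AlgebraicGeometry.Scheme.IdealSheafData.vanishingIdeal (⟨closure T₁, isClosed_closure⟩ : TopologicalSpace.Closeds F₁)).subschemeι x : F₁) ∈ closure L →
        Lt = some L) →
      (∀ L : Set F₁, Lt = some L → L ∈ Ls ∧ ∀ e : ↥(redSub F₁ (closure L) isClosed_closure), (redSubι F₁ (closure L) isClosed_closure e : F₁) =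
          ((AlgebraicGeometry.Scheme.IdealSheafData.vanishingIdeal (⟨closure T₁, isClosed_closure⟩ : TopologicalSpace.Closeds F₁)).subschemeι x : F₁) →
        IsRegularLocalRing ((redSub F₁ (closure L) isClosed_closure).presheaf.stalk e)) →
      (∀ K A C : Set F₁, Kp = some (K, A, C) →
        ((AlgebraicGeometry.Scheme.IdealSheafData.vanishingIdeal (⟨closure T₁, isClosed_closure⟩ : TopologicalSpace.Closeds F₁)).subschemeι x : F₁) ∉ closure K ∧
        ((AlgebraicGeometry.Scheme.IdealSheafData.vanishingIdeal (⟨closure T₁, isClosed_closure⟩ : TopologicalSpace.Closeds F₁)).subschemeι x : F₁) ∉ closure A ∧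
        ((AlgebraicGeometry.Scheme.IdealSheafData.vanishingIdeal (⟨closure T₁, isClosed_closure⟩ : TopologicalSpace.Closeds F₁)).subschemeι x : F₁) ∉ closure C) →
      Literature.AlgebraicGeometry.Resolution.IsBlowup υ
        (AlgebraicGeometry.Scheme.IdealSheafData.vanishingIdeal (⟨{((AlgebraicGeometry.Scheme.IdealSheafData.vanishingIdeal
            (⟨closure T₁, isClosed_closure⟩ : TopologicalSpace.Closeds F₁)).subschemeι x : F₁)}, hx⟩ : TopologicalSpace.Closeds F₁)) →
      ∀ Ls' : List (Set F₂),
        (Ls' = Ls.map (fun L => closure (υ ⁻¹' (L \ {((AlgebraicGeometry.Scheme.IdealSheafData.vanishingIdeal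
            (⟨closure T₁, isClosed_closure⟩ : TopologicalSpace.Closeds F₁)).subschemeι x : F₁)}))) ∨
         Ls' = Ls.map (fun L => closure (υ ⁻¹' (L \ {((AlgebraicGeometry.Scheme.IdealSheafData.vanishingIdeal
            (⟨closure T₁, isClosed_closure⟩ : TopologicalSpace.Closeds F₁)).subschemeι x : F₁)}))) ++
            [υ ⁻¹' {((AlgebraicGeometry.Scheme.IdealSheafData.vanishingIdeal (⟨closure T₁, isClosed_closure⟩ : TopologicalSpace.Closeds F₁)).subschemeι x : F₁)}]) →
        Q F₂ (υ ≫ ρ) (closure (υ ⁻¹' (T₁ \ {((AlgebraicGeometry.Scheme.IdealSheafData.vanishingIdeal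
            (⟨closure T₁, isClosed_closure⟩ : TopologicalSpace.Closeds F₁)).subschemeι x : F₁)}))) Ls'
          (Kp.map (fun t => (closure (υ ⁻¹' (t.1 \ {((AlgebraicGeometry.Scheme.IdealSheafData.vanishingIdeal
              (⟨closure T₁, isClosed_closure⟩ : TopologicalSpace.Closeds F₁)).subschemeι x : F₁)})),
            closure (υ ⁻¹' (t.2.1 \ {((AlgebraicGeometry.Scheme.IdealSheafData.vanishingIdeal
              (⟨closure T₁, isClosed_closure⟩ : TopologicalSpace.Closeds F₁)).subschemeι x : F₁)})),
            closure (υ ⁻¹' (t.2.2 \ {((AlgebraicGeometry.Scheme.IdealSheafData.vanishingIdeal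
              (⟨closure T₁, isClosed_closure⟩ : TopologicalSpace.Closeds F₁)).subschemeι x : F₁)})))))) →
    -- (O) CERTIFIED OPENING (opaque here; Defs8: `Open := OpeningCert k n H ι`, S10's «birth of M♮ + P(x₀) + CAR + PROMOTE» certificate list, text v1.1)
    (∀ (F₃ : AlgebraicGeometry.Scheme.{0}) (ρ₃ : F₃ ⟶ (Literature.AlgebraicGeometry.Motives.projectiveSpace n k).left) (T₃ : Set F₃) (Ls₃ : List (Set F₃))
        (Kp₃ : Option (Set F₃ × Set F₃ × Set F₃)), Open F₃ ρ₃ T₃ Ls₃ Kp₃ → Q F₃ ρ₃ T₃ Ls₃ Kp₃) →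
    -- (ii) PAIR ROUND at the transversal crossing curve `Z` of two listed letters `A ≠ B` (stage-level, (T-k)-free): `Z ⊆ T`, `T ⊄ Z`, `Z̃` regular, curve clause,
    --      `F` regular at the closed points of `Z`; the tag is absent or HOSTS (its pair is `{A, B}`, its key letter is listed and is not a member); every other
    --      listed letter does not contain `Z` and meets it transversally (possibly not at all); letters `↦ St`, tag consumed, optional birth of `E_Z = υ'⁻¹ Z`
    (∀ (F₁ F₃ : AlgebraicGeometry.Scheme.{0}) (ρ : F₁ ⟶ (Literature.AlgebraicGeometry.Motives.projectiveSpace n k).left) (T₁ : Set F₁) (Ls : List (Set F₁))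
        (Kp : Option (Set F₁ × Set F₁ × Set F₁)) (A B Z : Set F₁) (hZ : IsClosed Z) (υ' : F₃ ⟶ F₁),
      Q F₁ ρ T₁ Ls Kp → A ∈ Ls → B ∈ Ls → A ≠ B →
      AlgebraicGeometry.Scheme.IdealSheafData.vanishingIdeal (⟨closure A, isClosed_closure⟩ : TopologicalSpace.Closeds F₁) ⊔
          AlgebraicGeometry.Scheme.IdealSheafData.vanishingIdeal (⟨closure B, isClosed_closure⟩ : TopologicalSpace.Closeds F₁) =
        AlgebraicGeometry.Scheme.IdealSheafData.vanishingIdeal (⟨Z, hZ⟩ : TopologicalSpace.Closeds F₁) →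
      Z ⊆ T₁ → ¬ T₁ ⊆ Z → (∀ z : ↥(redSub F₁ Z hZ), IsRegularLocalRing ((redSub F₁ Z hZ).presheaf.stalk z)) →
      (∀ z : ↥(redSub F₁ Z hZ), IsClosed ({z} : Set ↥(redSub F₁ Z hZ)) → ringKrullDim ((redSub F₁ Z hZ).presheaf.stalk z) = ((1 : ℕ) : WithBot ℕ∞)) →
      (∀ z ∈ Z, IsClosed ({z} : Set F₁) → IsRegularLocalRing (F₁.presheaf.stalk z)) →
      (∀ K A' C' : Set F₁, Kp = some (K, A', C') → K ∈ Ls ∧ K ≠ A ∧ K ≠ B ∧ ((A' = A ∧ C' = B) ∨ (A' = B ∧ C' = A))) →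
      (∀ L ∈ Ls, L ≠ A → L ≠ B → (∀ K A' C' : Set F₁, Kp = some (K, A', C') → L ≠ K) →
        AlgebraicGeometry.Scheme.IdealSheafData.vanishingIdeal (⟨closure L, isClosed_closure⟩ : TopologicalSpace.Closeds F₁) ⊔
            AlgebraicGeometry.Scheme.IdealSheafData.vanishingIdeal (⟨Z, hZ⟩ : TopologicalSpace.Closeds F₁) =
          AlgebraicGeometry.Scheme.IdealSheafData.vanishingIdeal (⟨closure L ∩ Z, isClosed_closure.inter hZ⟩ : TopologicalSpace.Closeds F₁) ∧
        ∀ z ∈ Z, IsClosed ({z} : Set F₁) →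
          ¬ Literature.AlgebraicGeometry.Resolution.stalkIdeal (AlgebraicGeometry.Scheme.IdealSheafData.vanishingIdeal (⟨closure L, isClosed_closure⟩ : TopologicalSpace.Closeds F₁)) z ≤
            Literature.AlgebraicGeometry.Resolution.stalkIdeal (AlgebraicGeometry.Scheme.IdealSheafData.vanishingIdeal (⟨Z, hZ⟩ : TopologicalSpace.Closeds F₁)) z) →
      Literature.AlgebraicGeometry.Resolution.IsBlowup υ' (AlgebraicGeometry.Scheme.IdealSheafData.vanishingIdeal (⟨Z, hZ⟩ : TopologicalSpace.Closeds F₁)) →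
      ∀ Ls' : List (Set F₃),
        (Ls' = Ls.map (fun L => closure (υ' ⁻¹' (closure L \ Z))) ∨ Ls' = Ls.map (fun L => closure (υ' ⁻¹' (closure L \ Z))) ++ [υ' ⁻¹' Z]) →
        Q F₃ (υ' ≫ ρ) (closure (υ' ⁻¹' (T₁ \ Z))) Ls' none) →
    -- (HR-KEEP-N) NODAL HOSTED ROUND inside a listed host `E₁ ∈ Ls` THAT KEEPS ITS MEMBERS (WIDTH TABLE D8, desk R69; replaces Defs9's (HR-KEEP)): the (HR-KEEP)
    --      antecedents VERBATIM EXCEPT binder 5 «`Z̃` regular», which becomes (N1) «`Z̃` has FINITELY MANY non-regular points» (the tower carrier round's own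
    --      wording), and ONE added binder (N4) «a global section of the normal sheaf `𝒩_{Z̃/Ẽ₁}` that is a unit at every non-regular closed point of `Z̃`»
    --      placed after (N3) = `DirStepUnobs`; (N2) «`Ẽ₁` regular along `Z̃`» (so every singularity of `Z̃` is planar) and (N3) are byte-identical; curve clause,
    --      members block, blow-up and the ONE output (every listed letter `↦ St`, BIRTH of `E_Z = υ'⁻¹ Z`, tag dropped) byte-identical; supplier = ✓ `TCPlus.hround_keep`
    --      on the regular `O`-flat lift of `Z̃` (support debt S-D8-LIFT)
    (∀ (F₁ F₃ : AlgebraicGeometry.Scheme.{0}) (ρ : F₁ ⟶ (Literature.AlgebraicGeometry.Motives.projectiveSpace n k).left) (T₁ : Set F₁) (Ls : List (Set F₁))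
        (Kp : Option (Set F₁ × Set F₁ × Set F₁)) (E₁ : Set F₁) (Z : Set F₁) (hZ : IsClosed Z) (υ' : F₃ ⟶ F₁),
      Q F₁ ρ T₁ Ls Kp → E₁ ∈ Ls → Z ⊆ closure E₁ → Z ⊆ T₁ → ¬ T₁ ⊆ Z →
      Set.Finite {z : ↥(redSub F₁ Z hZ) | ¬ IsRegularLocalRing ((redSub F₁ Z hZ).presheaf.stalk z)} →
      (∀ (i : redSub F₁ Z hZ ⟶ redSub F₁ (closure E₁) isClosed_closure), i ≫ redSubι F₁ (closure E₁) isClosed_closure = redSubι F₁ Z hZ →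
        ∀ z : ↥(redSub F₁ Z hZ), IsRegularLocalRing ((redSub F₁ (closure E₁) isClosed_closure).presheaf.stalk (i z))) → DirStepUnobs F₁ (closure E₁) isClosed_closure Z hZ →
      (∀ (i : redSub F₁ Z hZ ⟶ redSub F₁ (closure E₁) isClosed_closure), i ≫ redSubι F₁ (closure E₁) isClosed_closure = redSubι F₁ Z hZ →
        ∃ ψ : Γ(Literature.AlgebraicGeometry.HodgeTheory.normalSheaf i, ⊤),
          ∀ z : ↥(redSub F₁ Z hZ), IsClosed ({z} : Set ↥(redSub F₁ Z hZ)) → ¬ IsRegularLocalRing ((redSub F₁ Z hZ).presheaf.stalk z) →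
            ∃ (U : (redSub F₁ (closure E₁) isClosed_closure).affineOpens) (hz : z ∈ i ⁻¹ᵁ (U : (redSub F₁ (closure E₁) isClosed_closure).Opens))
              (m : Γ(Literature.AlgebraicGeometry.Deformation.idealModule i, (U : (redSub F₁ (closure E₁) isClosed_closure).Opens))),
              IsUnit ((redSub F₁ Z hZ).presheaf.germ (i ⁻¹ᵁ (U : (redSub F₁ (closure E₁) isClosed_closure).Opens)) z hz
                (Literature.AlgebraicGeometry.HodgeTheory.normalSectionsVal i U
                  (Literature.AlgebraicGeometry.HodgeTheory.normalSheafSectionsEquiv i _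
                    ((Literature.AlgebraicGeometry.HodgeTheory.normalSheaf i).presheaf.map (homOfLE le_top).op ψ)) m))) →
      (∀ z : ↥(redSub F₁ Z hZ), IsClosed ({z} : Set ↥(redSub F₁ Z hZ)) → ringKrullDim ((redSub F₁ Z hZ).presheaf.stalk z) = ((1 : ℕ) : WithBot ℕ∞)) →
      (∀ L ∈ Ls, L ≠ E₁ →
        AlgebraicGeometry.Scheme.IdealSheafData.vanishingIdeal (⟨closure L, isClosed_closure⟩ : TopologicalSpace.Closeds F₁) ⊔
            AlgebraicGeometry.Scheme.IdealSheafData.vanishingIdeal (⟨Z, hZ⟩ : TopologicalSpace.Closeds F₁) =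
          AlgebraicGeometry.Scheme.IdealSheafData.vanishingIdeal (⟨closure L ∩ Z, isClosed_closure.inter hZ⟩ : TopologicalSpace.Closeds F₁) ∧
        ∀ z ∈ Z, IsClosed ({z} : Set F₁) →
          ¬ Literature.AlgebraicGeometry.Resolution.stalkIdeal (AlgebraicGeometry.Scheme.IdealSheafData.vanishingIdeal (⟨closure L, isClosed_closure⟩ : TopologicalSpace.Closeds F₁)) z ≤
            Literature.AlgebraicGeometry.Resolution.stalkIdeal (AlgebraicGeometry.Scheme.IdealSheafData.vanishingIdeal (⟨Z, hZ⟩ : TopologicalSpace.Closeds F₁)) z) →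
      Literature.AlgebraicGeometry.Resolution.IsBlowup υ' (AlgebraicGeometry.Scheme.IdealSheafData.vanishingIdeal (⟨Z, hZ⟩ : TopologicalSpace.Closeds F₁)) →
      Q F₃ (υ' ≫ ρ) (closure (υ' ⁻¹' (T₁ \ Z))) (Ls.map (fun L => closure (υ' ⁻¹' (closure L \ Z))) ++ [υ' ⁻¹' Z]) none) →
    -- (HR-SEC) Σ-SECTION HOSTED ROUND inside a listed host `E₁ ∈ Ls` THAT KEEPS ITS MEMBERS (WIDTH TABLE W₂, desk R73/R73a; idea-2 g30 l.86296): the (HR-KEEP-N)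
    --      clause above VERBATIM EXCEPT (N2) «`Ẽ₁` regular along `Z̃`» REPLACED by (L2) «at every closed point of `Z`, `𝓘⟨Z⟩` is `𝓘⟨Ẽ₁⟩` plus ONE element that is a
    --      PARAMETER» (stalk currency) and (N4) (the normal-section datum `ψ`) DELETED — no regularity of host or ambient is read; supplier = ✓ `embeddedLiftFact_holds`
    --      at the letter's model + (u2) «a flat lift of a Cartier-by-parameter divisor is principal and regular» (engine bullet, not in this file)
    (∀ (F₁ F₃ : AlgebraicGeometry.Scheme.{0}) (ρ : F₁ ⟶ (Literature.AlgebraicGeometry.Motives.projectiveSpace n k).left) (T₁ : Set F₁) (Ls : List (Set F₁))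
        (Kp : Option (Set F₁ × Set F₁ × Set F₁)) (E₁ : Set F₁) (Z : Set F₁) (hZ : IsClosed Z) (υ' : F₃ ⟶ F₁),
      Q F₁ ρ T₁ Ls Kp → E₁ ∈ Ls → Z ⊆ closure E₁ → Z ⊆ T₁ → ¬ T₁ ⊆ Z →
      Set.Finite {z : ↥(redSub F₁ Z hZ) | ¬ IsRegularLocalRing ((redSub F₁ Z hZ).presheaf.stalk z)} →
      (∀ z ∈ Z, IsClosed ({z} : Set F₁) → ∃ f : F₁.presheaf.stalk z,
        Literature.AlgebraicGeometry.Resolution.stalkIdeal (AlgebraicGeometry.Scheme.IdealSheafData.vanishingIdeal (⟨Z, hZ⟩ : TopologicalSpace.Closeds F₁)) z =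
            Literature.AlgebraicGeometry.Resolution.stalkIdeal (AlgebraicGeometry.Scheme.IdealSheafData.vanishingIdeal (⟨closure E₁, isClosed_closure⟩ : TopologicalSpace.Closeds F₁)) z ⊔
              Ideal.span {f} ∧
          f ∉ Literature.AlgebraicGeometry.Resolution.stalkIdeal (AlgebraicGeometry.Scheme.IdealSheafData.vanishingIdeal (⟨closure E₁, isClosed_closure⟩ : TopologicalSpace.Closeds F₁)) z ⊔
            (IsLocalRing.maximalIdeal (F₁.presheaf.stalk z)) ^ 2) →
      DirStepUnobs F₁ (closure E₁) isClosed_closure Z hZ →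
      (∀ z : ↥(redSub F₁ Z hZ), IsClosed ({z} : Set ↥(redSub F₁ Z hZ)) → ringKrullDim ((redSub F₁ Z hZ).presheaf.stalk z) = ((1 : ℕ) : WithBot ℕ∞)) →
      (∀ L ∈ Ls, L ≠ E₁ →
        AlgebraicGeometry.Scheme.IdealSheafData.vanishingIdeal (⟨closure L, isClosed_closure⟩ : TopologicalSpace.Closeds F₁) ⊔
            AlgebraicGeometry.Scheme.IdealSheafData.vanishingIdeal (⟨Z, hZ⟩ : TopologicalSpace.Closeds F₁) =
          AlgebraicGeometry.Scheme.IdealSheafData.vanishingIdeal (⟨closure L ∩ Z, isClosed_closure.inter hZ⟩ : TopologicalSpace.Closeds F₁) ∧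
        ∀ z ∈ Z, IsClosed ({z} : Set F₁) →
          ¬ Literature.AlgebraicGeometry.Resolution.stalkIdeal (AlgebraicGeometry.Scheme.IdealSheafData.vanishingIdeal (⟨closure L, isClosed_closure⟩ : TopologicalSpace.Closeds F₁)) z ≤
            Literature.AlgebraicGeometry.Resolution.stalkIdeal (AlgebraicGeometry.Scheme.IdealSheafData.vanishingIdeal (⟨Z, hZ⟩ : TopologicalSpace.Closeds F₁)) z) →
      Literature.AlgebraicGeometry.Resolution.IsBlowup υ' (AlgebraicGeometry.Scheme.IdealSheafData.vanishingIdeal (⟨Z, hZ⟩ : TopologicalSpace.Closeds F₁)) →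
      Q F₃ (υ' ≫ ρ) (closure (υ' ⁻¹' (T₁ \ Z))) (Ls.map (fun L => closure (υ' ⁻¹' (closure L \ Z))) ++ [υ' ⁻¹' Z]) none) →
    -- (P-ram) RAMIFIED POINT STEP AT A PREFIX POINT (the tail rule `TowerPtRamB₄`'s letters …NatTowerRoundBTriplePrimeDefs :69–:76, re-registered at prefix level,
    --      HOSTLESS, letters and tag DROPPED; idea-2 g30 l.86296): blow up a prescribed ideal `J` supported at a closed non-regular point of `T̃` where the AMBIENT
    --      is NOT regular, `J` generated in the stalk by three elements of `𝔪` independent in `𝔪/𝔪²`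
    (∀ (F₁ F₂ : AlgebraicGeometry.Scheme.{0}) (ρ : F₁ ⟶ (Literature.AlgebraicGeometry.Motives.projectiveSpace n k).left) (T₁ : Set F₁) (Ls : List (Set F₁))
        (Kp : Option (Set F₁ × Set F₁ × Set F₁)) (y : ↥(redSub F₁ (closure T₁) isClosed_closure)) (J : F₁.IdealSheafData) (υ₂ : F₂ ⟶ F₁),
      Q F₁ ρ T₁ Ls Kp →
      ¬ IsRegularLocalRing ((redSub F₁ (closure T₁) isClosed_closure).presheaf.stalk y) →
      ¬ IsRegularLocalRing (F₁.presheaf.stalk (curvePt F₁ T₁ y)) →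
      (J.support : Set F₁) = {curvePt F₁ T₁ y} →
      (∃ (ℓ : Fin 3 → F₁.presheaf.stalk (curvePt F₁ T₁ y)) (hℓ : ∀ i, ℓ i ∈ IsLocalRing.maximalIdeal (F₁.presheaf.stalk (curvePt F₁ T₁ y))),
        Literature.AlgebraicGeometry.Resolution.stalkIdeal J (curvePt F₁ T₁ y) = Ideal.span (Set.range ℓ) ∧
        LinearIndependent (IsLocalRing.ResidueField (F₁.presheaf.stalk (curvePt F₁ T₁ y)))
          (fun i => (IsLocalRing.maximalIdeal (F₁.presheaf.stalk (curvePt F₁ T₁ y))).toCotangent ⟨ℓ i, hℓ i⟩)) →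
      Literature.AlgebraicGeometry.Resolution.IsBlowup υ₂ J →
      Q F₂ (υ₂ ≫ ρ) (closure (υ₂ ⁻¹' (T₁ \ {curvePt F₁ T₁ y}))) [] none) →
    -- END (C3): the final slots are existential
    ∃ (Ls : List (Set F')) (Kp : Option (Set F' × Set F' × Set F')), Q F' ρ' T' Ls Kp

/-- **`PrefixReachKeyLetterP9 k n H ι F' ρ' T'`** — the W₂ PREFIX REACH: `PrefixReachKeyLetterParam9` at the same four slots as `PrefixReachKeyLetterP8`
(`Reach := ReachTowerBTriplePrime`, `ReachL := ReachTowerBQuintPrime ℙⁿ`, `LS := HyperplaneLetters`, `Open := OpeningCertKeyLetter`). [OURS · named predicate] -/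
def PrefixReachKeyLetterP9 (k : Type) [Field k] [IsAlgClosed k] (n : ℕ) (H : AlgebraicGeometry.Scheme.{0})
    (ι : H ⟶ (Literature.AlgebraicGeometry.Motives.projectiveSpace n k).left) (F' : AlgebraicGeometry.Scheme.{0}) (ρ' : F' ⟶ (Literature.AlgebraicGeometry.Motives.projectiveSpace n k).left) (T' : Set F') : Prop :=
  PrefixReachKeyLetterParam9 k n H ι ReachTowerBTriplePrime (ReachTowerBQuintPrime (Literature.AlgebraicGeometry.Motives.projectiveSpace n k).left) (HyperplaneLetters k n H ι) (OpeningCertKeyLetter k n H ι) F' ρ' T'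

/-- **`IsoHypReachNDLeavesP9 k n H ι`** — «a W₂ prefix (nodal hosted rounds, Σ-SECTION hosted rounds, ramified prefix point steps) ends at a stage with (pointwise) ND
LEAVES»: (K6-1P) over `PrefixReachKeyLetterP9`.  Customer of record: Q47₂.  The 48th = count-neutral ISO REPLACE `¬ IsoHypReachNDLeavesP8 ↦ ¬ IsoHypReachNDLeavesP9`.
[OURS · L1 W4.5b · named hypothesis, no mathematical content of its own] -/
def IsoHypReachNDLeavesP9 (k : Type) [Field k] [IsAlgClosed k] (n : ℕ) (H : AlgebraicGeometry.Scheme.{0})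
    (ι : H ⟶ (Literature.AlgebraicGeometry.Motives.projectiveSpace n k).left) : Prop :=
  ∃ (F : AlgebraicGeometry.Scheme.{0}) (ρ : F ⟶ (Literature.AlgebraicGeometry.Motives.projectiveSpace n k).left) (T : Set F) (m : ℕ),
    PrefixReachKeyLetterP9 k n H ι F ρ T ∧ ND.NDInvCLNP n k m F ρ T

/-- **Prefix⁸ ⊆ prefix⁹ (parametric)**: a motive closed under the P9 clauses is closed under the P8 clauses (the two new clauses are ADDED hypotheses). [OURS · pure logic] -/
theorem prefixReachKeyLetterParam9_of_param8 (k : Type) [Field k] [IsAlgClosed k] (n : ℕ) (H : AlgebraicGeometry.Scheme.{0})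
    (ι : H ⟶ (Literature.AlgebraicGeometry.Motives.projectiveSpace n k).left)
    (Reach : ∀ (F₁ F₂ : AlgebraicGeometry.Scheme.{0}), (F₂ ⟶ F₁) → F₁ → Set F₂ → ∀ (F₉ : AlgebraicGeometry.Scheme.{0}), (F₉ ⟶ F₂) → Set F₉ → Prop)
    (ReachL : ∀ (F₂ : AlgebraicGeometry.Scheme.{0}), (F₂ ⟶ (Literature.AlgebraicGeometry.Motives.projectiveSpace n k).left) →
      (Literature.AlgebraicGeometry.Motives.projectiveSpace n k).left → Set F₂ → List (Set F₂) → ∀ (F₉ : AlgebraicGeometry.Scheme.{0}), (F₉ ⟶ F₂) → Set F₉ → Prop)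
    (LS : ∀ (F₂ : AlgebraicGeometry.Scheme.{0}), (F₂ ⟶ (Literature.AlgebraicGeometry.Motives.projectiveSpace n k).left) → (Literature.AlgebraicGeometry.Motives.projectiveSpace n k).left → List (Set F₂) → Prop)
    (Open : ∀ (F₃ : AlgebraicGeometry.Scheme.{0}), (F₃ ⟶ (Literature.AlgebraicGeometry.Motives.projectiveSpace n k).left) → Set F₃ → List (Set F₃) → Option (Set F₃ × Set F₃ × Set F₃) → Prop)
    (F' : AlgebraicGeometry.Scheme.{0}) (ρ' : F' ⟶ (Literature.AlgebraicGeometry.Motives.projectiveSpace n k).left) (T' : Set F')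
    (h : PrefixReachKeyLetterParam8 k n H ι Reach ReachL LS Open F' ρ' T') : PrefixReachKeyLetterParam9 k n H ι Reach ReachL LS Open F' ρ' T' := by
  intro Q h0 hD hPc hPL hi hO hii hHRKN _ _
  exact h Q h0 hD hPc hPL hi hO hii hHRKN

/-- **Prefix⁸ ⊆ prefix⁹** at the four slots of record. [OURS · pure logic] -/
theorem prefixReachKeyLetterP9_of_P8 (k : Type) [Field k] [IsAlgClosed k] (n : ℕ) (H : AlgebraicGeometry.Scheme.{0})
    (ι : H ⟶ (Literature.AlgebraicGeometry.Motives.projectiveSpace n k).left) (F' : AlgebraicGeometry.Scheme.{0}) (ρ' : F' ⟶ (Literature.AlgebraicGeometry.Motives.projectiveSpace n k).left) (T' : Set F')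
    (h : PrefixReachKeyLetterP8 k n H ι F' ρ' T') : PrefixReachKeyLetterP9 k n H ι F' ρ' T' :=
  prefixReachKeyLetterParam9_of_param8 k n H ι _ _ _ _ F' ρ' T' h

/-- ★ **Inclusion P8 ⊆ P9** (the REPLACE cut `¬ IsoHypReachNDLeavesP8 ↦ ¬ IsoHypReachNDLeavesP9` loses nothing). [OURS · pure logic] -/
theorem isoHypReachNDLeavesP9_of_P8 (k : Type) [Field k] [IsAlgClosed k] (n : ℕ) (H : AlgebraicGeometry.Scheme.{0})
    (ι : H ⟶ (Literature.AlgebraicGeometry.Motives.projectiveSpace n k).left) (h : IsoHypReachNDLeavesP8 k n H ι) : IsoHypReachNDLeavesP9 k n H ι := by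
  obtain ⟨F, ρ, T, m, hP, hND⟩ := h
  exact ⟨F, ρ, T, m, prefixReachKeyLetterP9_of_P8 k n H ι F ρ T hP, hND⟩

/-- **Inclusion P7 ⊆ P9.** [OURS · pure logic] -/
theorem isoHypReachNDLeavesP9_of_P7 (k : Type) [Field k] [IsAlgClosed k] (n : ℕ) (H : AlgebraicGeometry.Scheme.{0})
    (ι : H ⟶ (Literature.AlgebraicGeometry.Motives.projectiveSpace n k).left) (h : IsoHypReachNDLeavesP7 k n H ι) : IsoHypReachNDLeavesP9 k n H ι :=
  isoHypReachNDLeavesP9_of_P8 k n H ι (isoHypReachNDLeavesP8_of_P7 k n H ι h)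

/-- **Inclusion P6 ⊆ P9.** [OURS · pure logic] -/
theorem isoHypReachNDLeavesP9_of_P6 (k : Type) [Field k] [IsAlgClosed k] (n : ℕ) (H : AlgebraicGeometry.Scheme.{0})
    (ι : H ⟶ (Literature.AlgebraicGeometry.Motives.projectiveSpace n k).left) (h : IsoHypReachNDLeavesP6 k n H ι) : IsoHypReachNDLeavesP9 k n H ι :=
  isoHypReachNDLeavesP9_of_P8 k n H ι (isoHypReachNDLeavesP8_of_P6 k n H ι h)

/-- **Inclusion P5 ⊆ P9.** [OURS · pure logic] -/
theorem isoHypReachNDLeavesP9_of_P5 (k : Type) [Field k] [IsAlgClosed k] (n : ℕ) (H : AlgebraicGeometry.Scheme.{0})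
    (ι : H ⟶ (Literature.AlgebraicGeometry.Motives.projectiveSpace n k).left) (h : IsoHypReachNDLeavesP5 k n H ι) : IsoHypReachNDLeavesP9 k n H ι :=
  isoHypReachNDLeavesP9_of_P8 k n H ι (isoHypReachNDLeavesP8_of_P5 k n H ι h)

/-- **Inclusion P ⊆ P9.** [OURS · pure logic] -/
theorem isoHypReachNDLeavesP9_of_P (k : Type) [Field k] [IsAlgClosed k] (n : ℕ) (H : AlgebraicGeometry.Scheme.{0})
    (ι : H ⟶ (Literature.AlgebraicGeometry.Motives.projectiveSpace n k).left) (h : IsoHypReachNDLeavesP k n H ι) : IsoHypReachNDLeavesP9 k n H ι :=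
  isoHypReachNDLeavesP9_of_P8 k n H ι (isoHypReachNDLeavesP8_of_P k n H ι h)

/-- The 48th's REPLACE lemma: `¬ IsoHypReachNDLeavesP9 → ¬ IsoHypReachNDLeavesP8`. [OURS · pure logic] -/
theorem not_isoHypReachNDLeavesP8_of_not_P9 (k : Type) [Field k] [IsAlgClosed k] (n : ℕ) (H : AlgebraicGeometry.Scheme.{0})
    (ι : H ⟶ (Literature.AlgebraicGeometry.Motives.projectiveSpace n k).left) (h : ¬ IsoHypReachNDLeavesP9 k n H ι) : ¬ IsoHypReachNDLeavesP8 k n H ι :=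
  fun h' => h (isoHypReachNDLeavesP9_of_P8 k n H ι h')

end Summit.ResolutionOfSingularities.ResolutionOfSingularities.Cruxes.EquisingularLiftNat.Sections

end
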